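import Mathlib
import Literature.NumberTheory.LFunctions.FeketePolynomial
import Summits.ValiantsHypothesis.ValiantsHypothesis.Theses.FeketeSOS

/-!
# Route FeketeSOS — `TrivialSupportBound` (item stmt-ValiantsHypothesis-3999)

The trivial counting bound of Dutta–Saxena–Thierauf [DuttaSaxenaThierauf2024, eq. (3):
`√(sp f) ≤ S(f)`] in the route's typing, with the symmetric-sumset constant: if
`Σ_{i<s} c_i g_i² = F_p = Σ_{m<p} (m/p) x^m` over `ℂ`, then the support-sum `S = Σ_i |supp g_i|`
satisfies `p − 1 ≤ S(S+1)/2`.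

Proof (all in `ℕ`, cast to `ℝ` at the end):
* `|supp F_p| = p − 1` — the tree's `Literature.NumberTheory.LFunctions.card_support_feketePolynomial`
  transported along `map_feketePolynomial_complex` (the route inlines the complex Fekete polynomial
  literally as that map) and `Polynomial.support_map_of_injective`;
* `supp (Σ_i c_i g_i²) ⊆ ⋃_i (supp g_i + supp g_i)` (a non-zero coefficient of a sum has a non-zero
  summand; a non-zero convolution coefficient has a non-zero term), so
  `p − 1 ≤ Σ_i |supp g_i + supp g_i|`;
* the symmetric sumset bound `2·|A + A| ≤ |A|(|A|+1)`: `A + A` is the image of the unordered pairs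
  `A.sym2` under `{a, b} ↦ a + b`, and `|A.sym2| = C(|A|+1, 2)` (`Finset.card_sym2`);
* `Σ_i |S_i|(|S_i|+1) ≤ S(S+1)` from `|S_i| ≤ S`.

No named facts are used; the result is unconditional.
-/

open Polynomial Finset
open scoped Pointwise

-- `Summit.ValiantsHypothesis.ValiantsHypothesis.…` is the tree's mandated single-conjunct layout
-- (Sub = Summit), so the duplicated namespace component is intended.
set_option linter.dupNamespace false

namespace Summit.ValiantsHypothesis.ValiantsHypothesis.Theorems.FeketeSOS

/-- **Symmetric sumset bound.** For a finite set `A` of naturals, `2·|A + A| ≤ |A|·(|A| + 1)`: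
every element of `A + A` is `a + b` for an unordered pair `{a, b}` from `A`, and there are
`C(|A|+1, 2) = |A|(|A|+1)/2` such pairs (`Finset.card_sym2`). [folklore] -/
theorem two_mul_card_add_self_le (A : Finset ℕ) :
    2 * (A + A).card ≤ A.card * (A.card + 1) := by
  classical
  have hsub : A + A ⊆ A.sym2.image
      (Sym2.lift ⟨fun a b : ℕ => a + b, fun a b => Nat.add_comm a b⟩) := by
    intro x hx
    obtain ⟨a, ha, b, hb, rfl⟩ := Finset.mem_add.mp hx
    exact Finset.mem_image.mpr ⟨s(a, b), Finset.mk_mem_sym2_iff.mpr ⟨ha, hb⟩, rfl⟩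
  have h1 : (A + A).card ≤ (A.card + 1).choose 2 :=
    calc (A + A).card
        ≤ (A.sym2.image (Sym2.lift ⟨fun a b : ℕ => a + b, fun a b => Nat.add_comm a b⟩)).card :=
          Finset.card_le_card hsub
      _ ≤ A.sym2.card := Finset.card_image_le
      _ = (A.card + 1).choose 2 := Finset.card_sym2 A
  have h2 : (A.card + 1).choose 2 = (A.card + 1) * A.card / 2 := by
    rw [Nat.choose_two_right, Nat.add_sub_cancel]
  rw [h2] at h1
  calc 2 * (A + A).card
      ≤ 2 * ((A.card + 1) * A.card / 2) := Nat.mul_le_mul_left 2 h1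
    _ ≤ (A.card + 1) * A.card := Nat.mul_div_le _ _
    _ = A.card * (A.card + 1) := Nat.mul_comm _ _

/-- `supp (f * g) ⊆ supp f + supp g` for complex polynomials: a non-zero convolution coefficient
`Σ_{a+b=n} f_a g_b` has a non-zero term. [folklore] -/
theorem support_mul_subset_add (f g : ℂ[X]) : (f * g).support ⊆ f.support + g.support := by
  intro n hn
  rw [mem_support_iff, coeff_mul] at hn
  obtain ⟨x, hx, hne⟩ := Finset.exists_ne_zero_of_sum_ne_zero hn
  rw [← Finset.HasAntidiagonal.mem_antidiagonal.mp hx]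
  exact Finset.add_mem_add (mem_support_iff.mpr (left_ne_zero_of_mul hne))
    (mem_support_iff.mpr (right_ne_zero_of_mul hne))

/-- The support of a weighted sum of squares `Σ_i c_i g_i²` lies in the union of the symmetric
sumsets `supp g_i + supp g_i`. [folklore] -/
theorem support_sum_C_mul_sq_subset {s : ℕ} (c : Fin s → ℂ) (g : Fin s → ℂ[X]) :
    (∑ i, C (c i) * g i ^ 2).support ⊆
      Finset.univ.biUnion fun i => (g i).support + (g i).support := by
  intro n hn
  rw [mem_support_iff, finsetSum_coeff] at hn
  obtain ⟨i, -, hne⟩ := Finset.exists_ne_zero_of_sum_ne_zero hn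
  rw [coeff_C_mul] at hne
  have hne' : (g i * g i).coeff n ≠ 0 := by
    rw [← pow_two]
    exact right_ne_zero_of_mul hne
  exact Finset.mem_biUnion.mpr
    ⟨i, Finset.mem_univ i, support_mul_subset_add _ _ (mem_support_iff.mpr hne')⟩

/-- **The trivial counting bound (DST24 eq. (3)) in the route's typing** — item
stmt-ValiantsHypothesis-3999, `FeketeSOS.TrivialSupportBound`: for every prime `p` and every
weighted SOS representation `Σ_{i<s} c_i g_i² = F_p` of the complex Fekete polynomial, the
support-sum `S = Σ_i |supp g_i|` satisfies `p − 1 ≤ S(S+1)/2`. Unconditional. -/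
theorem trivialSupportBound_proof :
    Summit.ValiantsHypothesis.ValiantsHypothesis.Theses.FeketeSOS.TrivialSupportBound := by
  unfold Summit.ValiantsHypothesis.ValiantsHypothesis.Theses.FeketeSOS.TrivialSupportBound
  intro p hp s c g hrep
  classical
  -- (1) `|supp F_p| = p - 1`, from the Literature file on Fekete polynomials
  have hF : (∑ m ∈ Finset.range p,
      Polynomial.C ((legendreSym p m : ℤ) : ℂ) * Polynomial.X ^ m).support.card = p - 1 := by
    rw [← Literature.NumberTheory.LFunctions.map_feketePolynomial_complex p,
      support_map_of_injective _ (RingHom.injective_int (Int.castRingHom ℂ)),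
      Literature.NumberTheory.LFunctions.card_support_feketePolynomial]
  -- (2) cover `supp F_p` by the symmetric sumsets of the `supp g_i`
  have hcover := support_sum_C_mul_sq_subset c g
  rw [hrep] at hcover
  have hcard : p - 1 ≤ ∑ i, ((g i).support + (g i).support).card := by
    rw [← hF]
    exact (Finset.card_le_card hcover).trans Finset.card_biUnion_le
  -- (3) sum the symmetric sumset bounds (in `ℕ`)
  set S : ℕ := ∑ i, (g i).support.card with hS
  have hSi : ∀ i, (g i).support.card ≤ S := fun i =>
    Finset.single_le_sum (f := fun j => (g j).support.card) (fun j _ => Nat.zero_le _)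
      (Finset.mem_univ i)
  have hmain : 2 * (p - 1) ≤ S * (S + 1) :=
    calc 2 * (p - 1)
        ≤ 2 * ∑ i, ((g i).support + (g i).support).card := Nat.mul_le_mul_left 2 hcard
      _ = ∑ i, 2 * ((g i).support + (g i).support).card := by rw [Finset.mul_sum]
      _ ≤ ∑ i, (g i).support.card * ((g i).support.card + 1) :=
          Finset.sum_le_sum fun i _ => two_mul_card_add_self_le _
      _ ≤ ∑ i, (g i).support.card * (S + 1) :=
          Finset.sum_le_sum fun i _ => Nat.mul_le_mul_left _ (Nat.succ_le_succ (hSi i))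
      _ = S * (S + 1) := by rw [hS, Finset.sum_mul]
  -- (4) cast to `ℝ`
  have hp1 : 1 ≤ p := hp.out.one_lt.le
  have hreal : ((2 * (p - 1) : ℕ) : ℝ) ≤ ((S * (S + 1) : ℕ) : ℝ) := by exact_mod_cast hmain
  push_cast [Nat.cast_sub hp1] at hreal
  have hSR : (∑ i, ((g i).support.card : ℝ)) = (S : ℝ) := by
    rw [hS, Nat.cast_sum]
  rw [hSR]
  linarith

end Summit.ValiantsHypothesis.ValiantsHypothesis.Theorems.FeketeSOS
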